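import Literature.Barriers.CriticalPhenomena.AmenableInvariantPercolationZd

/-!
# Barrier audit gen-11 (2026-08-15): SPARSE Thm. 8.37 witnesses and the additive-decorrelation
# dichotomy

Eleventh audit artifact (D-0021) of the catalogue entry `AmenableInvariantPercolation`
(Lyons–Peres 2016, Thm. 8.37, direction "amenable ⟹"; PROVED in the tree as
`AmenableInvariantPercolation_holds`, `AmenableInvariantPercolationProofs.lean`). Gens 1–10 sorted
the would-be evasions of the barrier by CLASSES of invariant percolations — finitely dependent,
Bernoulli-dominating, insertion-tolerant, negatively dependent, ψ-mixing at one distance: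
evasions; positively associated, factor of i.i.d., ergodic / mixing, finitary, thickened,
defect-set and entropy hypotheses: no evasion — and isolated the functional the Følner witnesses
exploit (cheap closed contours, gen-8). MIXING entered only qualitatively (gen-3: "stable under
independent intersection with the witnesses, hence no evasion"; gen-8: the witnesses are
α-mixing at rate `≍ 1/r` only). Gen-11 makes the RATE the variable and locates the exact line,
and records three further "import non-amenability from outside" doors, all closed in print.

## (E5) The additive-decorrelation dichotomy (on paper; the construction half is PROVED here)

For a probability measure `μ` on site configurations of `ℤ^d` and `r ≥ 1` put
`ᾱ_μ(r) := sup |μ(A ∩ B) - μ(A) μ(B)|`, the supremum over events `A ∈ σ(Λ)`, `B ∈ σ(Λ')` of two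
`ℓ^∞`-boxes `Λ, Λ'` of radius `≤ r` at `ℓ^∞`-distance `> r` (the strong-mixing coefficient for
comparable boxes; NO invariance, association or finite energy is assumed). Let
`ε : ℕ → [0, 1]` be non-increasing.

**(a) Threshold when `Σ_k ε(2^k) < ∞`.** For `d ≥ 2` there is `δ₀ = δ₀(d, ε) > 0` such that
every `μ` with `μ(x closed) ≤ δ₀` for all `x` and `ᾱ_μ ≤ ε` has `μ(0 ↔ ∞) ≥ 1/2`. So
"density `> 1 - δ₀`" is a size-blind finite-cluster threshold over the class `{μ : ᾱ_μ ≤ ε}`,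
its automorphism-invariant members included. Proof (static one-step renormalisation, no
sprinkling, no domination by product measures; the cascade of
[cite: PopovTeixeira2015, §8 (A^{k+1}_0 ⊆ ⋃ A^k_{x_i} ∩ A^k_{y_j}, dyadic scales L_k)] and of
Sznitman, Invent. Math. 187 (2012), with the sprinkled decoupling inequality replaced by the
additive one). Scales `L_k = L₀ 16^k`; `A_k(y) :=` "a `*`-path of closed sites leads from
`B(y, L_k)` out of `B(y, 2L_k)`", an event of the box `B(y, 2L_k)`; `p_k := sup_y μ(A_k(y))`.
A closed `*`-path realising `A_{k+1}(x)` realises `A_k(y) ∩ A_k(y')` for the points `y, y'` of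
`L_k ℤ^d` nearest to its endpoints; the boxes `B(y, 2L_k)`, `B(y', 2L_k)` have radius `2L_k` and
are more than `11 L_k` apart, and at most `C₁ = (15·16²)^d` such pairs occur; hence
`p_{k+1} ≤ C₁ (p_k² + ε(2L_k))`. If `p₀ ≤ 1/(2C₁)` and `ε(2L₀) ≤ 1/(4C₁²)` then inductively
`p_k ≤ 1/(2C₁)` and `p_{k+1} ≤ p_k/2 + C₁ ε(2L_k)`, so `Σ_k p_k ≤ 2p₀ + 2C₁ Σ_k ε(2L₀ 16^k)`.
Enclosure: if `0` is open with finite cluster `K`, the exterior vertex boundary of `K` visible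
from infinity, `S`, consists of CLOSED sites, separates `0` from `∞` and is `*`-connected
[cite: Timar2013, Thm. 3 (∂_vis(∞)(C) is *-connected for connected C ⊂ ℤ^d; after Deuschel–Pisztora)];
with `D := max_{s ∈ S} |s|_∞` it contains a point `s*` of norm `D` and a point `s'` on the
opposite coordinate ray, `|s' - s*|_∞ > D`; if `3L_k ≤ D < 3L_{k+1}` the `*`-path in `S` from
`s*` to `s'` realises `A_k(y)` for the grid point `y` nearest to `s*` (at most `C₂ = (7·16)^d`
candidates), and if `D < 3L₀` some site of `B(0, 3L₀)` is closed. So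
`μ(0 open, |K(0)| < ∞) ≤ (6L₀+1)^d δ + C₂ Σ_k p_k`, `δ := sup_x μ(x closed)`, with
`p₀ ≤ (4L₀+1)^d δ`. Take `L₀ = 2^m` with `ε(2L₀) ≤ 1/(4C₁²)` and
`2C₁C₂ Σ_{j>m} ε(2^j) ≤ 1/8` (dyadic summability), then `δ₀` with
`((6L₀+1)^d + 2C₂(4L₀+1)^d) δ₀ ≤ 1/8` and `(4L₀+1)^d δ₀ ≤ 1/(2C₁)`:
`μ(0 open, |K(0)| < ∞) ≤ 1/4 ≤ μ(0 open) - 1/2`.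

**(b) No threshold when `Σ_k ε(2^k) = ∞`.** For every `d` and `α < 1` there is an
`Aut(ℤ^d)`-invariant site percolation on `ℤ^d` with a.s. only finite clusters, density `> α` and
`ᾱ_μ(r) ≤ ε(r)` for all `r ≥ 1`: the SPARSE witness `perc (zdGraph d) F q` of `perc_sparse`
below with templates `F n =` the box of radius `2^n` (whose copies are its translates,
`N_n = |F n|`), activation intensities `a n := min(1, ε(2^{n+1})/C_d)` for `n ≥ n₀` and `a n := 0`
for `n < n₀`, `C_d := 72 d 3^{d-1}` (`Σ_n a n = ∞` because `Σ_k ε(2^k) = ∞`; budget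
`b n = a n |∂_E F n| / |F n| ≤ 2d a n / 2^{n+1}`, so the density is `≥ 1 - 2d 2^{-n₀}`). Invariance,
finiteness of all clusters and the density bound are PROVED (`perc_sparse`; the book's witnesses
are `a ≡ 1`); the decorrelation estimate is on paper: for boxes `Λ, Λ'` of radius `≤ r` at
distance `> r` let `Z` be the event that some ACTIVATED copy `t + F n` with `diam_∞ F n > r`
(`2^{n+1} > r`) has inner boundary meeting `Λ ∪ Λ'`. Copies of the other levels have diameter
`≤ r` and cannot meet both boxes, so off `Z` the configurations on `Λ` and on `Λ'` are functions
of two disjoint families of coins, both independent of `Z`; hence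
`|μ(A ∩ B) - μ(A)μ(B)| ≤ 3 μ(Z)`, and
`μ(Z) ≤ Σ_{2^{n+1} > r} (a n / |F n|) · #{t : ∂_in(t + F n) ∩ (Λ ∪ Λ') ≠ ∅}`
`≤ Σ_{2^{n+1} > r} (a n / |F n|) · 2 · 2d (2r+1) (3 · side(F n))^{d-1} ≤ 4 d 3^{d-1} (2r+1) Σ_{2^{n+1} > r} a n 2^{-n-1}`
`≤ 24 d 3^{d-1} sup_{2^{n+1} > r} a n`, i.e. `ᾱ_μ(r) ≤ C_d sup_{2^{n+1} > r} a n ≤ ε(r)` (`ε`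
non-increasing). The dichotomy is therefore SHARP at dyadic summability for monotone envelopes:
`ε(r) = 1/log(2+r)` is carried by finite-cluster invariant percolations of every density,
`ε(r) = 1/log^{1+s}(2+r)` forces an infinite cluster above density `1 - δ₀(d, s)`. (A
single-scale witness — cubes of side `R` — decorrelates exponentially beyond `R`, but the
envelope of the family `R → ∞` is constant at `r = R`: class-uniformity is the point, as for the
coding radius in gen-6 (E1).)

**(c) Reading.** (a) is the first catalogued evasion that is NOT a closed-contour device (gen-8,
(2)): Peierls' estimate is unavailable under additive errors, and members of the class may close
a large finite `F` with probability far above `64^{-|F|}` (superpose on Bernoulli(`1 - δ₀/2`) closed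
balls of radius `R` with intensity `c δ₀ e^{-R} R^{-2d}` per centre and radius: correlations
`e^{-r/4}`-summable, one-site cost `≤ δ₀/2`, yet `P[that ball closed] ≥ c δ₀ e^{-R} R^{-2d} ≫ 64^{-|B_R|}`). It refines gen-3: "mixing" is stable
under intersection with the witnesses only down to the witnesses' own rate, and the witnesses can
be made to decorrelate at every dyadically non-summable rate but — by (a) — no faster. Among
ADDITIVE decorrelation conditions (strong mixing, absolute regularity) dyadic summability of a
class-uniform envelope is thus exactly the information the Følner obstruction cannot fake, while
φ- or ψ-mixing at ONE distance `r₀` already restores a threshold (chain rule along an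
`r₀`-separated net of a closed `*`-contour, `P[contour of n sites closed] ≤ (δ + φ(r₀))^{n/(2r₀+1)^d}`;
gen-8 for ψ). For the BLPS percolations `ξ_ε` on `ℤ³` [cite: LyonsPeres2016, Thm. 8.21 (proof)]
none of this is a lever: `ω_{p_c}` itself is i.i.d. (`ᾱ ≡ 0`), the dependence of `ξ_ε` being
carried by the non-local nearest-point field `W`; (a) converts "`θ(p_c) > 0`" into
"`Σ_k u(2^k) = ∞`" for the failure probability `u(ρ)` of a `ρ`-local approximation of `W` (local
non-uniqueness of the critical infinite cluster at scale `ρ`), a same-`p` statement along dyadic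
scales that is weaker than gen-6 (E1)'s pointwise `u(ρ) ≥ c/ρ` and, like it, a finite-size
criterion in disguise.

## Three more "import non-amenability" doors, and a sibling route (closed in print)

Gen-10 closed the auxiliary non-amenable structures living ON `ℤ³` (sub-relations, finite-
intensity drawings, quotients with infinite fibres). Gen-11 closes those living NEAR, ABOVE and
BESIDE it. (A1) LOCAL APPROXIMATION — run BLPS on non-amenable transitive `G_n → ℤ³` in the local
topology and pass to the limit with the locality of `p_c` [cite: EasoHutchcroft2023, Thm. 1.1]:
impossible, since a connected graph weakly `3`-locally `ℤ^d`, `d ≥ 3`, is normally covered by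
`ℤ^d` [cite: BenjaminiEllis2014, Thm. 4 (d ≥ 3: weakly 3-locally 𝕃^d ⟹ normal covering map 𝕃^d → G) and Cor. 5],
hence a quotient `ℤ^d/Γ` of polynomial growth — amenable; and along the amenable approximants
that do exist (toroidal slabs `ℤ² × ℤ/n → ℤ³`) the passage at `p = p_c` is the open
locality-at-criticality problem [cite: EasoHutchcroft2023, §7.1 ("The case p = p_c(G) appears to be hard" — toroidal slabs and DCST16)]
(`SlabLimitUniformControl`). (A2) COVERING LIFTS `π : G̃ → ℤ³` with `G̃` non-amenable
(`Cay(ℤ × F₂)`, the tree `T₆`, …; on paper): the lift `ω ∘ π` of a `Γ`-invariant percolation is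
invariant under the lifted group, which acts transitively, but a component of `π⁻¹(K)` over a
cluster `K` is finite iff `K` is finite AND the image of its cycles in the deck group is finite —
over the universal cover iff `K` is a finite TREE — so of the upstairs threshold
[cite: LyonsPeres2016, Thm. 8.16] only the forest bound `E[deg_𝔉 o] < 2`
[cite: LyonsPeres2016, Exercise 8.10] descends (valid downstairs anyway), while `π⁻¹(ω_p)`
percolates upstairs for EVERY `p > 0` (a finite cluster containing a square with non-trivial
monodromy lifts to an infinite component, one containing two independent such squares to a
component of exponential growth) and is neither Bernoulli
nor insertion-tolerant: no criticality upstairs. (A3) NONSINGULAR REWEIGHTING — make `ℤ³`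
"non-amenable with respect to a cocycle" by passing to a quasi-invariant, non-invariant law:
the orbit relation of every nonsingular action of an amenable group is amenable, hence
hyperfinite, and so is every subrelation
[cite: ConnesFeldmanWeiss1981, Thm. 10 and Cor. 18 (p. 431: actions of amenable groups; §2: subrelations)];
quasi-pmp non-amenability criteria (three non-vanishing ends, Chen–Terlov–Tserunyan) never fire
over `ℤ³`. (C) The SIBLING non-amenable route to `θ(p_c) = 0` — Hutchcroft's `L²`-boundedness
criterion `p_c < p_{2→2}` ⟹ `∇_{p_c} ≤ ‖T_{p_c}‖³_{2→2} < ∞` ⟹ mean-field criticality — is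
outside this entry's technique class (no invariant-percolation threshold) and void on every
amenable quasi-transitive graph for its own one-line reason: `p_c < p_{2→2}` implies `p_c < p_u`
(`‖T_p‖_{2→2} = ∞` for `p > p_u` by Harris–FKG), whereas `p_c = p_u` on amenable quasi-transitive
graphs [cite: Hutchcroft2020L2, §1 (p_c = p_{1→1}; Conj. 1.3 for NONamenable G; "(conj:pcp22) implies (conj:pcpu)"; p_c = p_u for amenable quasi-transitive graphs)].
Entry CONFIRMED (proof re-checked: rc 0, axioms `propext`, `Classical.choice`, `Quot.sound`,
statement read back by `rfl`; p. 412 of the held Lyons–Peres re-read); literature to 2026-08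
(arXiv; OpenAlex / Semantic Scholar over budget during the session): nothing on `θ(p_c)` for
nearest-neighbour percolation on transitive graphs of polynomial growth with `3 ≤ d ≤ 10` beyond
the evasions already listed.

## Contents (namespace `Literature.Barriers.CriticalPhenomena`)

* `coinMeasure_forall_eq_false_le_exp` — coverage with general intensities:
  `P[no activated copy through x among levels < m] ≤ exp(-Σ_{n<m} a n)`;
* `perc_sparse` — for templates `F n`, intensities `a n ∈ [0,1]` with `Σ a n = ∞` and a summable
  budget `b n ≥ a n |∂_E F n|/|F n|`: `perc G F q`, `q n N_n = a n`, is invariant, has a.s. finite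
  clusters and density `≥ 1 - Σ b n`;
* `AmenableInvariantPercolation_sparse`, `AmenableInvariantPercolation_sparse_zd` — density
  `> α` for every `α < 1` and every admissible `a` (on any connected, locally finite, transitive,
  amenable `G`; on `ℤ^d` unconditionally).

## References

* R. Lyons, Y. Peres, *Probability on Trees and Networks*, CUP 2016, Thm. 8.37 (p. 412; proof
  pp. 412–413: `ζ` Bernoulli(`1/|F|`), (8.23)–(8.25)), Thm. 8.16, Exercise 8.10, Thm. 8.21.
  [LyonsPeres2016]
* S. Popov, A. Teixeira, *Soft local times and decoupling of random interlacements*, JEMS 17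
  (2015) 2545–2593 (arXiv:1212.1605), §3 (after Thm. 3.1: "for any percolation model with
  suitable monotonicity and decoupling properties … the proof would go through practically
  unaltered") and §8 (renormalisation scheme). [PopovTeixeira2015] A.-S. Sznitman, Invent. Math.
  187 (2012) 645–706; S. A. Molchanov, A. K. Stepanov, Theor. Math. Phys. 55 (1983) (percolation
  of random fields under polynomial mixing).
* Á. Timár, *Boundary-connectivity via graph theory*, PAMS 141 (2013), Thm. 3. [Timar2013]
* I. Benjamini, D. Ellis, *On the structure of graphs which are locally indistinguishable from a
  lattice*, Forum Math. Sigma 4 (2016) e31 (arXiv:1409.7587), Thm. 4, Cor. 5. [BenjaminiEllis2014]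
  M. de la Salle, R. Tessera, *Characterizing a vertex-transitive graph by a large ball*,
  J. Topol. 12 (2019).
* P. Easo, T. Hutchcroft, *The critical percolation probability is local*, arXiv:2310.10983,
  Thm. 1.1, §7.1, Thm. 7.1. [EasoHutchcroft2023]
* A. Connes, J. Feldman, B. Weiss, Ergodic Theory Dynam. Systems 1 (1981) 431–450, Thm. 10,
  Cor. 18. [ConnesFeldmanWeiss1981] R. Chen, G. Terlov, A. Tserunyan, *Nonamenable subforests of
  multi-ended quasi-pmp graphs* (preprint).
* T. Hutchcroft, *The L² boundedness condition in nonamenable percolation*, Electron. J. Probab.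
  25 (2020), paper 127 (arXiv:1904.05804), §1. [Hutchcroft2020L2] T. Hutchcroft, *Percolation on
  hyperbolic graphs*, GAFA 29 (2019) 766–810.
-/

namespace Literature.Barriers.CriticalPhenomena

open Literature.Probability.LatticeModels Literature.Probability.Percolation Finset
open MeasureTheory ProbabilityTheory unitInterval Filter Topology

variable {V : Type*} {G : SimpleGraph V}

/-- Coverage estimate with general activation intensities: if the coins of level `n` show heads
with probability `q n` and `q n · |T n| = a n`, then all the coins `⟨n, C⟩`, `C ∈ T n`, `n < m`,
show `false` with probability at most `exp (-(a 0 + ⋯ + a (m - 1)))`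
(`(1 - a/N)^N ≤ e^{-a}`); cf. (8.24) in [cite: LyonsPeres2016, Thm. 8.37 (proof)]. -/
theorem coinMeasure_forall_eq_false_le_exp (q : ℕ → I) (T : ℕ → Finset (Finset V)) (a : ℕ → ℝ)
    (hq : ∀ n, (q n : ℝ) * (T n).card = a n) (m : ℕ) :
    coinMeasure q {η : Idx V → Bool | ∀ n, ∀ C ∈ T n, η ⟨n, C⟩ = false} ≤
      ENNReal.ofReal (Real.exp (-(∑ n ∈ Finset.range m, a n))) := by
  refine (coinMeasure_forall_eq_false_le q T m).trans ?_
  have hq1 : ∀ n, (toNNReal (σ (q n)) : ENNReal) = ENNReal.ofReal (1 - (q n : ℝ)) := fun n => by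
    rw [← ENNReal.ofReal_coe_nnreal, coe_toNNReal, coe_symm_eq]
  have hterm : ∀ n, (toNNReal (σ (q n)) : ENNReal) ^ (T n).card ≤
      ENNReal.ofReal (Real.exp (-a n)) := by
    intro n
    rw [hq1, ← ENNReal.ofReal_pow (sub_nonneg.2 (q n).2.2)]
    refine ENNReal.ofReal_le_ofReal ?_
    calc (1 - (q n : ℝ)) ^ (T n).card ≤ (Real.exp (-(q n : ℝ))) ^ (T n).card :=
          pow_le_pow_left₀ (sub_nonneg.2 (q n).2.2) (Real.one_sub_le_exp_neg _) _
      _ = Real.exp (-a n) := by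
          rw [← Real.exp_nat_mul, ← hq n]
          congr 1
          ring
  calc ∏ n ∈ Finset.range m, (toNNReal (σ (q n)) : ENNReal) ^ (T n).card
      ≤ ∏ n ∈ Finset.range m, ENNReal.ofReal (Real.exp (-a n)) :=
        Finset.prod_le_prod (fun _ _ => zero_le) fun n _ => hterm n
    _ = ENNReal.ofReal (∏ n ∈ Finset.range m, Real.exp (-a n)) :=
        (ENNReal.ofReal_prod_of_nonneg fun n _ => (Real.exp_pos _).le).symm
    _ = ENNReal.ofReal (Real.exp (-(∑ n ∈ Finset.range m, a n))) := by
        rw [← Real.exp_sum, ← Finset.sum_neg_distrib]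

/-- **Sparse Thm. 8.37 witnesses, general form.** Connected, locally finite, transitive, amenable
`G`; finite non-empty templates `F n`; activation intensities `a n ∈ [0, 1]` with
`Σ_n a n = ∞`; a budget `b n ≥ a n · |∂_E F n| / |F n|` with `Σ_n b n < ∞`. Then for the
activation probabilities `q n := a n / N_n` (`N_n` = the number of copies of `F n` through a
vertex, so that a vertex is covered by `a n` activated copies of `F n` on average) the law
`perc G F q` — remove the inner vertex boundary of every activated copy `γ F n`, independently
over all copies and levels — is an automorphism-invariant site percolation with a.s. only finite
clusters and `P[x ∈ ω] ≥ 1 - Σ_n b n` at every vertex. The book's choice is `a ≡ 1`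
[cite: LyonsPeres2016, Thm. 8.37 (proof: ζ Bernoulli(1/|F|), (8.23)–(8.25))]; letting `a n → 0`
along a divergent series places the level-`n` walls arbitrarily sparsely (gen-11 audit: additive
decorrelation at every rate with divergent dyadic sum, module docstring (E5)(b)). -/
theorem perc_sparse {V : Type} [DecidableEq V] {G : SimpleGraph V} [G.LocallyFinite]
    (hc : G.Connected) (ht : IsGraphTransitive G) (ha : IsGraphAmenable G)
    (F : ℕ → Finset V) (hFne : ∀ n, (F n).Nonempty)
    (a : ℕ → ℝ) (ha0 : ∀ n, 0 ≤ a n) (ha1 : ∀ n, a n ≤ 1)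
    (hdiv : Tendsto (fun m => ∑ n ∈ Finset.range m, a n) atTop atTop)
    (b : ℕ → ℝ) (hb : ∀ n, a n * (edgeBoundary G (F n)).card ≤ b n * (F n).card)
    (hbs : Summable b) :
    ∃ q : ℕ → I,
      (∀ n x, (q n : ℝ) * (through G (F n) x).ncard = a n) ∧
      IsInvariantSitePercolation G (perc G F q) ∧
      (∀ᵐ ω ∂(perc G F q), ∀ x : V, (siteCluster G ω x).Finite) ∧
      ∀ x : V, 1 - ∑' n, b n ≤ (perc G F q).real {ω | x ∈ ω} := by
  classical
  haveI : Countable V := countable_of_connected hc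
  obtain ⟨o⟩ := hc.nonempty
  have hbnn : ∀ n, 0 ≤ b n := fun n => by
    have hFpos : (0 : ℝ) < (F n).card := by exact_mod_cast (hFne n).card_pos
    have h := (mul_nonneg (ha0 n) (Nat.cast_nonneg _)).trans (hb n)
    exact nonneg_of_mul_nonneg_left h hFpos
  -- `N n` = number of copies of `F n` through a vertex (independent of the vertex)
  set N : ℕ → ℕ := fun n => (through G (F n) o).ncard with hN
  have hNx : ∀ n x, (through G (F n) x).ncard = N n := fun n x => ncard_through_eq ht (F n) x o
  have hNpos : ∀ n, 0 < N n := fun n =>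
    (Set.ncard_pos (through_finite hc (F n) o)).2 (through_nonempty ht (hFne n) o)
  have hNpos' : ∀ n, (0 : ℝ) < N n := fun n => by exact_mod_cast hNpos n
  have hN1 : ∀ n, (1 : ℝ) ≤ N n := fun n => by exact_mod_cast hNpos n
  -- activation probabilities `q n = a n / N n`
  have hqle : ∀ n, a n / (N n : ℝ) ≤ 1 := fun n =>
    (div_le_one (hNpos' n)).2 ((ha1 n).trans (hN1 n))
  set q : ℕ → I := fun n => ⟨a n / (N n : ℝ), div_nonneg (ha0 n) (Nat.cast_nonneg _), hqle n⟩
    with hq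
  have hqcoe : ∀ n, (q n : ℝ) = a n / (N n : ℝ) := fun n => rfl
  have hqN : ∀ n, (q n : ℝ) * N n = a n := fun n => by
    rw [hqcoe, div_mul_cancel₀ _ (hNpos' n).ne']
  have hmeas := measurable_config (G := G) F
  refine ⟨q, fun n x => by rw [hNx n x]; exact hqN n, isInvariantSitePercolation_perc F q, ?_, ?_⟩
  · /- finite clusters almost surely: every vertex lies in an activated copy, since
      `P[no activated copy through x among the levels n < m] ≤ exp (-Σ_{n<m} a n) → 0` -/
    set T : ℕ → V → Finset (Finset V) := fun n x => (through_finite hc (F n) x).toFinset with hT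
    have hTmem : ∀ n x C, C ∈ T n x ↔ C ∈ through G (F n) x := fun n x C =>
      Set.Finite.mem_toFinset _
    have hTcard : ∀ n x, (T n x).card = N n := fun n x => by
      rw [← hNx n x, Set.ncard_eq_toFinset_card _ (through_finite hc (F n) x)]
    have hnull : ∀ x,
        coinMeasure q {η : Idx V → Bool | ∀ n, ∀ C ∈ T n x, η ⟨n, C⟩ = false} = 0 := by
      intro x
      have hbound : ∀ m, coinMeasure q {η : Idx V → Bool | ∀ n, ∀ C ∈ T n x, η ⟨n, C⟩ = false} ≤
          ENNReal.ofReal (Real.exp (-(∑ n ∈ Finset.range m, a n))) := fun m =>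
        coinMeasure_forall_eq_false_le_exp q (fun n => T n x) a
          (fun n => by rw [hTcard n x]; exact hqN n) m
      have htend : Tendsto (fun m => ENNReal.ofReal (Real.exp (-(∑ n ∈ Finset.range m, a n))))
          atTop (𝓝 0) := by
        rw [← ENNReal.ofReal_zero]
        exact ENNReal.tendsto_ofReal
          (Real.tendsto_exp_atBot.comp (tendsto_neg_atTop_atBot.comp hdiv))
      exact le_antisymm (ge_of_tendsto' htend hbound) zero_le
    have hW : ∀ᵐ η ∂coinMeasure q, ∀ x, ∃ n C, C ∈ through G (F n) x ∧ η ⟨n, C⟩ = true := by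
      rw [ae_iff]
      refine measure_mono_null ?_ (measure_iUnion_null hnull)
      intro η hη
      rw [Set.mem_setOf_eq] at hη
      push Not at hη
      obtain ⟨x, hx⟩ := hη
      simp only [Set.mem_iUnion, Set.mem_setOf_eq]
      refine ⟨x, fun n C hC => ?_⟩
      simpa using hx n C ((hTmem n x C).1 hC)
    have hWg : ∀ᵐ η ∂coinMeasure q, config G F η ∈ goodEvent G :=
      hW.mono fun η hη => config_mem_goodEvent hη
    have hpre : coinMeasure q (config G F ⁻¹' goodEvent G) = 1 := by
      rw [← prob_compl_eq_zero_iff (hmeas measurableSet_goodEvent)]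
      rw [ae_iff] at hWg
      exact hWg
    have hperc : ∀ᵐ ω ∂perc G F q, ω ∈ goodEvent G := by
      rw [Filter.Eventually, mem_ae_iff, Set.setOf_mem_eq,
        prob_compl_eq_zero_iff measurableSet_goodEvent, perc,
        Measure.map_apply hmeas measurableSet_goodEvent]
      exact hpre
    exact hperc.mono fun ω hω x => finite_siteCluster_of_mem_goodEvent hω x
  · /- density: `P[x closed] ≤ Σ_n q n · #{copies C of F n with x ∈ ∂_in C} ≤ Σ_n b n` -/
    intro x
    have hmeasS : MeasurableSet {ω : Set V | x ∈ ω} := measurableSet_mem x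
    have hBfin : ∀ n, (bthrough G (F n) x).Finite := fun n =>
      (through_finite hc (F n) x).subset (bthrough_subset_through _ _)
    set B : ℕ → Finset (Finset V) := fun n => (hBfin n).toFinset with hB
    have hBmem : ∀ n C, C ∈ copies G (F n) → x ∈ innerBoundary G C → C ∈ B n :=
      fun n C hC hx => (Set.Finite.mem_toFinset _).2 ⟨hC, hx⟩
    have hBcard : ∀ n, ((B n).card : ℝ) * (q n : ℝ) ≤ b n := by
      intro n
      have h1 := ncard_bthrough_mul_card_le hc ht ha (F n) x
      rw [hNx n x] at h1
      have hcardB : (B n).card = (bthrough G (F n) x).ncard :=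
        (Set.ncard_eq_toFinset_card _ (hBfin n)).symm
      have hFpos : (0 : ℝ) < (F n).card := by exact_mod_cast (hFne n).card_pos
      have hN0 : (N n : ℝ) ≠ 0 := (hNpos' n).ne'
      -- `|B n| · |F n| · a n ≤ N n · (a n |∂_E F n|) ≤ N n · b n · |F n|`
      have h2 : ((bthrough G (F n) x).ncard : ℝ) * (F n).card * a n ≤ N n * (b n * (F n).card) :=
        calc ((bthrough G (F n) x).ncard : ℝ) * (F n).card * a n
            ≤ (N n * (edgeBoundary G (F n)).card) * a n :=
              mul_le_mul_of_nonneg_right (by exact_mod_cast h1) (ha0 n)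
          _ = N n * (a n * (edgeBoundary G (F n)).card) := by ring
          _ ≤ N n * (b n * (F n).card) := mul_le_mul_of_nonneg_left (hb n) (Nat.cast_nonneg _)
      have h3 : ((bthrough G (F n) x).ncard : ℝ) * a n ≤ N n * b n := by
        have h2' : ((bthrough G (F n) x).ncard : ℝ) * a n * (F n).card ≤ N n * b n * (F n).card := by
          calc ((bthrough G (F n) x).ncard : ℝ) * a n * (F n).card
              = ((bthrough G (F n) x).ncard : ℝ) * (F n).card * a n := by ring
            _ ≤ N n * (b n * (F n).card) := h2
            _ = N n * b n * (F n).card := by ring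
        exact le_of_mul_le_mul_right h2' hFpos
      rw [hcardB, hqcoe]
      calc ((bthrough G (F n) x).ncard : ℝ) * (a n / N n)
          = ((bthrough G (F n) x).ncard : ℝ) * a n / N n := by ring
        _ ≤ N n * b n / N n := by gcongr
        _ = b n := by field_simp
    have hbad : coinMeasure q {η | x ∉ config G F η} ≤ ENNReal.ofReal (∑' n, b n) := by
      calc coinMeasure q {η | x ∉ config G F η}
          ≤ ∑' n, ((B n).card : ENNReal) * toNNReal (q n) :=
            coinMeasure_not_mem_config_le F q x B hBmem
        _ ≤ ∑' n, ENNReal.ofReal (b n) := by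
            refine ENNReal.tsum_le_tsum fun n => ?_
            have : ((B n).card : ENNReal) * toNNReal (q n) =
                ENNReal.ofReal (((B n).card : ℝ) * (q n : ℝ)) := by
              rw [ENNReal.ofReal_mul (Nat.cast_nonneg _), ENNReal.ofReal_natCast,
                ← ENNReal.ofReal_coe_nnreal, coe_toNNReal]
            rw [this]
            exact ENNReal.ofReal_le_ofReal (hBcard n)
        _ = ENNReal.ofReal (∑' n, b n) := (ENNReal.ofReal_tsum_of_nonneg hbnn hbs).symm
    have hcomplS : MeasurableSet {η : Idx V → Bool | x ∉ config G F η} := (hmeas hmeasS).compl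
    have hgood :
        coinMeasure q {η | x ∈ config G F η} = 1 - coinMeasure q {η | x ∉ config G F η} := by
      rw [← prob_compl_eq_one_sub hcomplS]
      congr 1
      ext η
      simp only [Set.mem_setOf_eq, Set.mem_compl_iff, not_not]
    rw [measureReal_def, perc, Measure.map_apply hmeas hmeasS]
    change 1 - ∑' n, b n ≤ (coinMeasure q {η | x ∈ config G F η}).toReal
    rw [hgood, ENNReal.toReal_sub_of_le prob_le_one ENNReal.one_ne_top, ENNReal.toReal_one]
    have : (coinMeasure q {η | x ∉ config G F η}).toReal ≤ ∑' n, b n :=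
      ENNReal.toReal_le_of_le_ofReal (tsum_nonneg hbnn) hbad
    linarith

/-- **Sparse Thm. 8.37 witnesses of prescribed density.** On a connected, locally finite,
transitive, amenable graph: for every `α < 1` and every sequence of activation intensities
`a n ∈ [0, 1]` with `Σ_n a n = ∞` there are finite non-empty Følner templates `F n` and
activation probabilities `q n` with `q n · N_n = a n` such that `perc G F q` is an
automorphism-invariant site percolation with a.s. only finite clusters and density `> α`. With
`a ≡ 1` this is `AmenableInvariantPercolation_holds` [cite: LyonsPeres2016, Thm. 8.37]. -/
theorem AmenableInvariantPercolation_sparse {V : Type} [DecidableEq V] (G : SimpleGraph V)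
    [G.LocallyFinite] (hc : G.Connected) (ht : IsGraphTransitive G) (ha : IsGraphAmenable G)
    (a : ℕ → ℝ) (ha0 : ∀ n, 0 ≤ a n) (ha1 : ∀ n, a n ≤ 1)
    (hdiv : Tendsto (fun m => ∑ n ∈ Finset.range m, a n) atTop atTop) {α : ℝ} (hα : α < 1) :
    ∃ (F : ℕ → Finset V) (q : ℕ → I),
      (∀ n, (F n).Nonempty) ∧
      (∀ n x, (q n : ℝ) * (through G (F n) x).ncard = a n) ∧
      IsInvariantSitePercolation G (perc G F q) ∧
      (∀ᵐ ω ∂(perc G F q), ∀ x : V, (siteCluster G ω x).Finite) ∧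
      ∀ x : V, α < (perc G F q).real {ω | x ∈ ω} := by
  -- the budget `δ = 1 - α`, split as `ε n = δ / 2^(n+2)`
  set δ : ℝ := 1 - α with hδ
  have hδpos : 0 < δ := by rw [hδ]; linarith
  set ε : ℕ → ℝ := fun n => δ / 2 / 2 / 2 ^ n with hε
  have hεpos : ∀ n, 0 < ε n := fun n => by positivity
  -- Følner sets `F n` with `|∂_E F n| ≤ ε n |F n|`
  choose F hFne hFbd using fun n => ha (ε n) (hεpos n)
  have hb : ∀ n, a n * ((edgeBoundary G (F n)).card : ℝ) ≤ ε n * (F n).card := fun n =>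
    calc a n * ((edgeBoundary G (F n)).card : ℝ) ≤ 1 * (edgeBoundary G (F n)).card := by
          gcongr; exact ha1 n
      _ = (edgeBoundary G (F n)).card := one_mul _
      _ ≤ ε n * (F n).card := hFbd n
  obtain ⟨q, hqN, hinv, hfin, hdens⟩ :=
    perc_sparse hc ht ha F hFne a ha0 ha1 hdiv ε hb (summable_geometric_two' _)
  refine ⟨F, q, hFne, hqN, hinv, hfin, fun x => lt_of_lt_of_le ?_ (hdens x)⟩
  rw [hε, tsum_geometric_two', hδ]
  linarith

/-- The sparse witnesses on `ℤ^d`, unconditionally (connectedness, transitivity and amenability of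
`zdGraph d` are proved in `AmenableInvariantPercolationZd.lean`): for every `α < 1` and every
`a n ∈ [0, 1]` with `Σ_n a n = ∞`, `ℤ^d` carries an `Aut(ℤ^d)`-invariant finite-cluster site
percolation of density `> α` whose level-`n` walls have activation intensity exactly `a n`.
[cite: LyonsPeres2016, Thm. 8.37] -/
theorem AmenableInvariantPercolation_sparse_zd (d : ℕ) (a : ℕ → ℝ) (ha0 : ∀ n, 0 ≤ a n)
    (ha1 : ∀ n, a n ≤ 1) (hdiv : Tendsto (fun m => ∑ n ∈ Finset.range m, a n) atTop atTop)
    {α : ℝ} (hα : α < 1) :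
    ∃ (F : ℕ → Finset (Site d)) (q : ℕ → I),
      (∀ n, (F n).Nonempty) ∧
      (∀ n x, (q n : ℝ) * (through (zdGraph d) (F n) x).ncard = a n) ∧
      IsInvariantSitePercolation (zdGraph d) (perc (zdGraph d) F q) ∧
      (∀ᵐ ω ∂(perc (zdGraph d) F q), ∀ x : Site d, (siteCluster (zdGraph d) ω x).Finite) ∧
      ∀ x : Site d, α < (perc (zdGraph d) F q).real {ω | x ∈ ω} :=
  AmenableInvariantPercolation_sparse (zdGraph d) (zdGraph_connected d) (isGraphTransitive_zdGraph d)
    (isGraphAmenable_zdGraph d) a ha0 ha1 hdiv hα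

end Literature.Barriers.CriticalPhenomena
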